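import Literature.MathematicalPhysics.QuantumLattice.HubbardGridFieldSubstitution
import Literature.Analysis.Fourier.MatsubaraSummationByParts
import Literature.Probability.LatticeModels.TorusFourierWeightedL1
import HarnessLib

/-!
# Weighted Plancherel on the `N`-point Matsubara time grid × the torus `(ℤ/Lℤ)^d`: `ℓ¹` norms of space–time
# propagator kernels from `ℓ²` norms of symbol differences (M-uniform for SHARPLY truncated frequency windows)

Topic `MathematicalPhysics/QuantumLattice`; the space–TIME companion of
`Literature.Probability.LatticeModels.TorusFourierWeightedL1` (position directions) and the `L²` companion of
`Literature.Analysis.Fourier.MatsubaraSummationByParts` (sup-norm decay in `x₀`).  A fermionic propagator kernel pulled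
back to the time grid `τ_j = jβ/N`, `j < N` (`gridTime`, `HubbardGridFieldSubstitution`), and to the sites of `(ℤ/Lℤ)^d`,

  `K(j, x) = Σ_{n ∈ [A, B]} e^{-iω_n τ_j} Σ_k χ_k(x) F(n, k)`,   `ω_n = π(2n+1)/β`,

is a character sum in every variable.  As long as the frequency WINDOW fits the grid (`B - A + 1 ≤ N`; for the tree's
`2M` sharply truncated frequencies on the `4M` grid, `2M ≤ 4M`) the grid characters `j ↦ e^{-iπ(2n+1)j/N}` of distinct
`n` in the window are orthogonal (`sum_exp_freqTransfer_gridTime`), so Plancherel holds in time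
(`sum_norm_sq_matsubara_sum_gridTime`) exactly as on the torus (`sum_norm_sq_sum_torusChar_mul`); the summation-by-parts
identities (`sub_one_pow_smul_sum_phase`: `(e^{-2πij/N} - 1)^P Σ_n e^{-iω_nτ_j} c(n) = Σ_n e^{-iω_nτ_j} (∇^P c)(n)`,
support growing to `[A, B + P]`) turn polynomial weights in the grid distance `|j̃|` (`j̃` the minimal representative of
`j mod N`, chord bound `4|j̃|/N ≤ 2|sin(πj/N)|`) into `ℓ²` norms of DIFFERENCES of the symbol in `n`, sharp edges of the
window included (their differences are just the edge values — no smoothness across the truncation is assumed), and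
Cauchy–Schwarz with the additive weight `W(j,x) = 1 + c_τ (4|j̃|/N)^{2P_τ} + Σ_i c_i (4|ã_{v_i}(x)|/L)^{2P}` gives the
`ℓ¹` norm `Σ_{j,x} ‖K(j,x)‖ ≤ (Σ W⁻¹)^{1/2} (N L^d [‖F‖₂² + c_τ ‖∇^{P_τ} F‖₂² + Σ_i c_i ‖Δ_{v_i}^P F‖₂²])^{1/2}`
(`sum_norm_gridKernel_le`).  With `c_τ = (β/4T)^{2P_τ}`, `c_i = (L/4)^{2P}` and the mean-value bounds
`|∇^P c| ≤ (2π/β)^P sup|∂_ω^P f|`, `|Δ^P| ≤ (2π/L)^P sup|∂_k^P f|` every `β` and `L` cancels — this is the route to the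
`M`-, `β`-, `L`-uniform DECAY CONSTANT (`Σ_Y ‖C X Y‖`) of the scale-`0` covariance of the Hubbard torus on the `4M` grid
(cell gate-hubbard-kl, crux K3 child ENGINE, stub `stub_engine_scale0`, hypothesis `hrow/hcol` of
`GrassmannEffectiveActionBoundDB.sum_norm_kernel_effAction_le_of_gramBounded`).

* `cexp_matsubara_gridTime` — at grid times the Matsubara phase is `e^{-iπ(2n+1)j/N}` (no `β`);
* `sum_cexp_matsubara_gridTime_mul_conj` — orthogonality of the grid characters of a window of length `≤ N`;
* **`sum_norm_sq_matsubara_sum_gridTime`** — time Plancherel: `Σ_{j<N} ‖Σ_{n∈[A,B]} e^{-iω_nτ_j} c(n)‖² = N Σ_n ‖c(n)‖²`;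
* `four_mul_abs_valMinAbs_div_le` — chord bound `4|j̃|/N ≤ 2|sin(πj/N)|`;
* **`sum_weight_mul_norm_sq_matsubara_sum_le`** — weighted time Plancherel with `P` differences;
* `sum_sum_norm_sq_gridKernel`, `sum_sum_timeWeight_mul_norm_sq_gridKernel_le`, `sum_sum_spaceWeight_mul_norm_sq_gridKernel_le`
  — joint (time × torus) Plancherel, plain and weighted;
* **`sum_norm_gridKernel_le`** — the `ℓ¹` bound with the additive space–time weight.

Everything is proved; no definitions, no named facts.  The geometry of the weight (`Σ W⁻¹`) and the mean-value bounds on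
the differences of a concrete symbol are left to the user (cf. `TorusFourierWeightedL1`).

## Sources

G. Benfatto, A. Giuliani, V. Mastropietro, Ann. Henri Poincaré 7 (2006) 809–898, Lemma 2.2, (2.36aa), footnote ¹
(finite `L`) [`BenfattoGiulianiMastropietro2006`]; M. Salmhofer, *Renormalization* (1999), §4.2.4 (4.55)–(4.59) (the time
lattice and its orthogonality relation) [`Salmhofer1999`]; W. de Siqueira Pedra, M. Salmhofer, Comm. Math. Phys. 282 (2008)
797–818, §4 (decay constants `α_C` of positive-temperature covariances) [`PedraSalmhofer2008`].  The lemmas are routine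
("folklore").
-/

noncomputable section

namespace Literature.MathematicalPhysics.QuantumLattice

open Finset Complex Literature.Probability.LatticeModels Literature.Analysis.Fourier
open scoped Real ComplexConjugate

/-! ### §1 The Matsubara phase at grid times and the orthogonality of the grid characters -/

/-- **At the grid time `τ_j = jβ/N` the Matsubara phase `e^{-iω_n τ_j}` is `e^{-iπ(2n+1)j/N}`** — `β` drops out
(`β ≠ 0`). [cite: Salmhofer1999, §4.2.4 (4.55)] -/
theorem cexp_matsubara_gridTime {β : ℝ} (hβ : β ≠ 0) (N : ℕ) (n : ℤ) (j : Fin N) :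
    cexp (-(I * ((π * (2 * (n : ℝ) + 1) / β * gridTime β N j : ℝ) : ℂ))) =
      cexp (-(I * ((π * (2 * (n : ℝ) + 1) * (j : ℕ) / N : ℝ) : ℂ))) := by
  have hN : (N : ℝ) ≠ 0 := by exact_mod_cast (Fin.pos j).ne'
  have h : π * (2 * (n : ℝ) + 1) / β * gridTime β N j = π * (2 * (n : ℝ) + 1) * (j : ℕ) / N := by
    rw [gridTime]; field_simp
  rw [h]

/-- **Orthogonality of the grid characters of a frequency window**: for integers `n, n'` with `|n - n'| < N`,
`Σ_{j<N} e^{-iω_n τ_j} conj(e^{-iω_{n'} τ_j}) = N·[n = n']` (`= Σ_j e^{2πi(n'-n)jβ/(Nβ)}`, `sum_exp_freqTransfer_gridTime`).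
[cite: Salmhofer1999, §4.2.4 (4.59)] -/
theorem sum_cexp_matsubara_gridTime_mul_conj {β : ℝ} (hβ : β ≠ 0) {N : ℕ} {n n' : ℤ} (h : (n - n').natAbs < N) :
    ∑ j : Fin N, cexp (-(I * ((π * (2 * (n : ℝ) + 1) / β * gridTime β N j : ℝ) : ℂ))) *
        conj (cexp (-(I * ((π * (2 * (n' : ℝ) + 1) / β * gridTime β N j : ℝ) : ℂ)))) =
      if n = n' then (N : ℂ) else 0 := by
  have hm : (n' - n).natAbs < N := by rwa [← Int.natAbs_neg, neg_sub]
  have h1 := sum_exp_freqTransfer_gridTime hβ (N := N) hm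
  have hterm : ∀ j : Fin N,
      cexp (-(I * ((π * (2 * (n : ℝ) + 1) / β * gridTime β N j : ℝ) : ℂ))) *
          conj (cexp (-(I * ((π * (2 * (n' : ℝ) + 1) / β * gridTime β N j : ℝ) : ℂ)))) =
        Complex.exp (((2 * Real.pi * ((n' - n : ℤ) : ℝ) * gridTime β N j / β : ℝ) : ℂ) * Complex.I) := by
    intro j
    rw [← Complex.exp_conj, ← Complex.exp_add]
    congr 1
    simp only [map_neg, map_mul, Complex.conj_I, Complex.conj_ofReal]
    push_cast
    ring
  simp_rw [hterm]
  rw [h1]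
  by_cases hnn : n = n'
  · subst hnn; simp
  · rw [if_neg (sub_ne_zero.2 (Ne.symm hnn)), if_neg hnn]

/-! ### §2 Plancherel on the time grid for a frequency window of length `≤ N` -/

/-- **Time Plancherel**: for any `c : ℤ → ℂ` and a window `[A, B]` with `B - A + 1 ≤ N`,
`Σ_{j<N} ‖Σ_{n ∈ [A,B]} e^{-iω_n τ_j} c(n)‖² = N · Σ_{n ∈ [A,B]} ‖c(n)‖²` (the grid characters of the window are
orthogonal). [cite: Salmhofer1999, §4.2.4 (4.59)] -/
theorem sum_norm_sq_matsubara_sum_gridTime {β : ℝ} (hβ : β ≠ 0) {N : ℕ} {A B : ℤ} (hAB : B - A + 1 ≤ N)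
    (c : ℤ → ℂ) :
    ∑ j : Fin N, ‖∑ n ∈ Icc A B, cexp (-(I * ((π * (2 * (n : ℝ) + 1) / β * gridTime β N j : ℝ) : ℂ))) * c n‖ ^ 2 =
      (N : ℝ) * ∑ n ∈ Icc A B, ‖c n‖ ^ 2 := by
  set θ : ℤ → Fin N → ℂ := fun n j => cexp (-(I * ((π * (2 * (n : ℝ) + 1) / β * gridTime β N j : ℝ) : ℂ)))
    with hθ
  have hfold : ∀ (n : ℤ) (j : Fin N),
      cexp (-(I * ((π * (2 * (n : ℝ) + 1) / β * gridTime β N j : ℝ) : ℂ))) = θ n j := fun _ _ => rfl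
  have horth : ∀ n ∈ Icc A B, ∀ n' ∈ Icc A B,
      ∑ j : Fin N, θ n j * conj (θ n' j) = if n = n' then (N : ℂ) else 0 := by
    intro n hn n' hn'
    have h : (n - n').natAbs < N := by rw [mem_Icc] at hn hn'; omega
    exact sum_cexp_matsubara_gridTime_mul_conj hβ h
  have key : ∀ j : Fin N, ((‖∑ n ∈ Icc A B, θ n j * c n‖ : ℝ) : ℂ) ^ 2 =
      ∑ n ∈ Icc A B, ∑ n' ∈ Icc A B, (θ n j * conj (θ n' j)) * (c n * conj (c n')) := by
    intro j
    rw [← Complex.mul_conj', map_sum, sum_mul_sum]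
    refine sum_congr rfl fun n _ => sum_congr rfl fun n' _ => ?_
    rw [map_mul]; ring
  simp only [hfold]
  apply Complex.ofReal_injective
  rw [Complex.ofReal_sum]
  conv_rhs => rw [Complex.ofReal_mul, Complex.ofReal_natCast, Complex.ofReal_sum]
  simp only [Complex.ofReal_pow]
  rw [sum_congr rfl fun j _ => key j, sum_comm, mul_sum]
  refine sum_congr rfl fun n hn => ?_
  rw [sum_comm]
  simp_rw [← sum_mul]
  rw [sum_eq_single n]
  · rw [horth n hn n hn, if_pos rfl, Complex.mul_conj']
  · intro n' hn' hne
    rw [horth n hn n' hn', if_neg (Ne.symm hne), zero_mul]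
  · intro h; exact absurd hn h

/-! ### §3 Weighted time Plancherel: `P` differences of the symbol pay the weight `(2|sin(πj/N)|)^{2P}` -/

/-- `‖e^{-i(2π/β)τ_j} - 1‖ = 2|sin(πj/N)|` — the summation-by-parts multiplier at a grid time (Mastropietro's `d_L`,
BGM's `d_β`, read on the grid). [cite: Mastropietro2008, Lemma 3.2 (3.19)] -/
theorem norm_cexp_step_gridTime_sub_one {β : ℝ} (hβ : β ≠ 0) (N : ℕ) (j : Fin N) :
    ‖cexp (-(I * ((2 * π / β * gridTime β N j : ℝ) : ℂ))) - 1‖ = 2 * |Real.sin (π * (j : ℕ) / N)| := by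
  have hN : (N : ℝ) ≠ 0 := by exact_mod_cast (Fin.pos j).ne'
  rw [norm_cexp_neg_mul_sub_one]
  congr 2
  rw [gridTime]
  field_simp

/-- **The chord bound on the time grid**: `4|j̃|/N ≤ 2|sin(πj/N)|`, `j̃ = ZMod.valMinAbs (j mod N)` the minimal
representative (`|j̃| ≤ N/2`; Jordan's inequality) — the grid form of BGM's `|d_β(x₀)| ≥ (2/π)|x₀|_β`.
[cite: BenfattoGiulianiMastropietro2006, §2.5 Lemma 2.2 (2.52)] -/
theorem four_mul_abs_valMinAbs_div_le (N : ℕ) [NeZero N] (j : ℕ) :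
    4 * |(((j : ZMod N)).valMinAbs : ℝ)| / N ≤ 2 * |Real.sin (π * j / N)| := by
  -- the torus chord bound in dimension one, direction `1`, at the point `j`
  have h := le_norm_torusChar_sub_one (d := 1) (L := N) (fun _ => (1 : ZMod N)) (fun _ => (j : ZMod N))
  have hsum : (∑ i : Fin 1, (fun _ : Fin 1 => (1 : ZMod N)) i * (fun _ : Fin 1 => (j : ZMod N)) i) = (j : ZMod N) := by
    simp
  rw [hsum] at h
  have hchar : torusChar (d := 1) (L := N) (fun _ => (1 : ZMod N)) (fun _ => (j : ZMod N)) =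
      Complex.exp (I * ((2 * π * j / N : ℝ) : ℂ)) := by
    rw [torusChar, Fin.prod_univ_one, one_mul, show ((j : ℕ) : ZMod N) = ((j : ℤ) : ZMod N) by simp,
      ZMod.stdAddChar_coe]
    congr 1
    push_cast
    ring
  rw [hchar, Complex.norm_exp_I_mul_ofReal_sub_one, Real.norm_eq_abs, abs_mul, abs_two,
    show (2 * π * (j : ℝ) / N / 2 : ℝ) = π * j / N by ring] at h
  exact h

/-- **Weighted time Plancherel** (exact): for `c : ℤ → ℂ` vanishing off `[A, B]` and `B + P - A + 1 ≤ N`,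
`Σ_{j<N} (2|sin(πj/N)|)^{2P} ‖Σ_{n∈[A,B]} e^{-iω_nτ_j} c(n)‖² = N Σ_{n ∈ [A,B+P]} ‖(∇^P c)(n)‖²`, `∇c(n) = c(n-1) - c(n)`
(summation by parts `sub_one_pow_smul_sum_phase`, then `sum_norm_sq_matsubara_sum_gridTime` on the enlarged window —
the edges of a sharp window are differenced like everything else). [cite: BenfattoGiulianiMastropietro2006, §2.5 Lemma 2.2 (2.56)] -/
theorem sum_sin_pow_mul_norm_sq_matsubara_sum_gridTime {β : ℝ} (hβ : β ≠ 0) {N : ℕ} {A B : ℤ} (P : ℕ)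
    (hAB : B + P - A + 1 ≤ N) (c : ℤ → ℂ) (hc : ∀ n, n ∉ Icc A B → c n = 0) :
    ∑ j : Fin N, (2 * |Real.sin (π * (j : ℕ) / N)|) ^ (2 * P) *
        ‖∑ n ∈ Icc A B, cexp (-(I * ((π * (2 * (n : ℝ) + 1) / β * gridTime β N j : ℝ) : ℂ))) * c n‖ ^ 2 =
      (N : ℝ) * ∑ n ∈ Icc A (B + P), ‖((fwdDiff (-1 : ℤ))^[P] c) n‖ ^ 2 := by
  have hid : ∀ j : Fin N,
      (cexp (-(I * ((2 * π / β * gridTime β N j : ℝ) : ℂ))) - 1) ^ P *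
          ∑ n ∈ Icc A B, cexp (-(I * ((π * (2 * (n : ℝ) + 1) / β * gridTime β N j : ℝ) : ℂ))) * c n =
        ∑ n ∈ Icc A (B + P), cexp (-(I * ((π * (2 * (n : ℝ) + 1) / β * gridTime β N j : ℝ) : ℂ))) *
          ((fwdDiff (-1 : ℤ))^[P] c) n := by
    intro j
    have h := sub_one_pow_smul_sum_phase P c hc (π / β) (2 * π / β) (gridTime β N j)
    simp only [smul_eq_mul, matsubara_phase_eq] at h
    exact h
  have hsq : ∀ j : Fin N, (2 * |Real.sin (π * (j : ℕ) / N)|) ^ (2 * P) *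
        ‖∑ n ∈ Icc A B, cexp (-(I * ((π * (2 * (n : ℝ) + 1) / β * gridTime β N j : ℝ) : ℂ))) * c n‖ ^ 2 =
      ‖∑ n ∈ Icc A (B + P), cexp (-(I * ((π * (2 * (n : ℝ) + 1) / β * gridTime β N j : ℝ) : ℂ))) *
          ((fwdDiff (-1 : ℤ))^[P] c) n‖ ^ 2 := by
    intro j
    rw [← hid j, norm_mul, norm_pow, norm_cexp_step_gridTime_sub_one hβ]
    ring
  rw [sum_congr rfl fun j _ => hsq j]
  exact sum_norm_sq_matsubara_sum_gridTime hβ (by omega) _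

/-- **Weighted time Plancherel, chord form**: `Σ_{j<N} (4|j̃|/N)^{2P} ‖Σ_n e^{-iω_nτ_j} c(n)‖² ≤ N Σ_{n∈[A,B+P]} ‖(∇^P c)(n)‖²`.
[cite: BenfattoGiulianiMastropietro2006, §2.5 Lemma 2.2 (2.56)] -/
theorem sum_weight_mul_norm_sq_matsubara_sum_le {β : ℝ} (hβ : β ≠ 0) {N : ℕ} [NeZero N] {A B : ℤ} (P : ℕ)
    (hAB : B + P - A + 1 ≤ N) (c : ℤ → ℂ) (hc : ∀ n, n ∉ Icc A B → c n = 0) :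
    ∑ j : Fin N, (4 * |(((j : ℕ) : ZMod N).valMinAbs : ℝ)| / N) ^ (2 * P) *
        ‖∑ n ∈ Icc A B, cexp (-(I * ((π * (2 * (n : ℝ) + 1) / β * gridTime β N j : ℝ) : ℂ))) * c n‖ ^ 2 ≤
      (N : ℝ) * ∑ n ∈ Icc A (B + P), ‖((fwdDiff (-1 : ℤ))^[P] c) n‖ ^ 2 := by
  rw [← sum_sin_pow_mul_norm_sq_matsubara_sum_gridTime hβ P hAB c hc]
  refine sum_le_sum fun j _ => mul_le_mul_of_nonneg_right ?_ (sq_nonneg _)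
  exact pow_le_pow_left₀ (by positivity) (four_mul_abs_valMinAbs_div_le N j) _

/-! ### §4 Space–time kernels: joint Plancherel (plain and weighted) and the `ℓ¹` bound -/

section SpaceTime

variable {d L : ℕ} [NeZero L]

/-- Exchanging the order of the character sums: `Σ_n e^{-iω_nτ} Σ_k χ_k(x) F(n,k) = Σ_k χ_k(x) Σ_n e^{-iω_nτ} F(n,k)`. [folklore] -/
private theorem gridKernel_eq_sum_torusChar {β : ℝ} {N : ℕ} (S : Finset ℤ) (F : ℤ → TorusSite d L → ℂ) (j : Fin N)
    (x : TorusSite d L) :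
    ∑ n ∈ S, cexp (-(I * ((π * (2 * (n : ℝ) + 1) / β * gridTime β N j : ℝ) : ℂ))) * ∑ k, torusChar k x * F n k =
      ∑ k, torusChar k x *
        ∑ n ∈ S, cexp (-(I * ((π * (2 * (n : ℝ) + 1) / β * gridTime β N j : ℝ) : ℂ))) * F n k := by
  simp_rw [mul_sum]
  rw [sum_comm]
  exact sum_congr rfl fun k _ => sum_congr rfl fun n _ => by ring

/-- **Joint Plancherel**: `Σ_{j<N} Σ_x ‖K(j,x)‖² = N L^d Σ_{n∈[A,B]} Σ_k ‖F(n,k)‖²` for the space–time kernel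
`K(j,x) = Σ_{n∈[A,B]} e^{-iω_nτ_j} Σ_k χ_k(x) F(n,k)` of a window with `B - A + 1 ≤ N`. [cite: Salmhofer1999, §4.2.4 (4.59)] -/
theorem sum_sum_norm_sq_gridKernel {β : ℝ} (hβ : β ≠ 0) {N : ℕ} {A B : ℤ} (hAB : B - A + 1 ≤ N)
    (F : ℤ → TorusSite d L → ℂ) :
    ∑ j : Fin N, ∑ x : TorusSite d L,
        ‖∑ n ∈ Icc A B, cexp (-(I * ((π * (2 * (n : ℝ) + 1) / β * gridTime β N j : ℝ) : ℂ))) *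
            ∑ k, torusChar k x * F n k‖ ^ 2 =
      (N : ℝ) * (L : ℝ) ^ d * ∑ n ∈ Icc A B, ∑ k, ‖F n k‖ ^ 2 := by
  simp_rw [gridKernel_eq_sum_torusChar, sum_norm_sq_sum_torusChar_mul]
  rw [← mul_sum, sum_comm]
  simp_rw [sum_norm_sq_matsubara_sum_gridTime hβ hAB]
  rw [← mul_sum, sum_comm]
  ring

/-- **Time-weighted joint Plancherel**: for `F` vanishing off the window `[A, B]` (in `n`) and `B + P - A + 1 ≤ N`,
`Σ_{j<N} Σ_x (2|sin(πj/N)|)^{2P} ‖K(j,x)‖² = N L^d Σ_{n∈[A,B+P]} Σ_k ‖(∇_n^P F)(n,k)‖²`.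
[cite: BenfattoGiulianiMastropietro2006, §2.5 Lemma 2.2 (2.56)] -/
theorem sum_sum_sin_pow_mul_norm_sq_gridKernel {β : ℝ} (hβ : β ≠ 0) {N : ℕ} {A B : ℤ} (P : ℕ)
    (hAB : B + P - A + 1 ≤ N) (F : ℤ → TorusSite d L → ℂ) (hF : ∀ n, n ∉ Icc A B → F n = 0) :
    ∑ j : Fin N, ∑ x : TorusSite d L, (2 * |Real.sin (π * (j : ℕ) / N)|) ^ (2 * P) *
        ‖∑ n ∈ Icc A B, cexp (-(I * ((π * (2 * (n : ℝ) + 1) / β * gridTime β N j : ℝ) : ℂ))) *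
            ∑ k, torusChar k x * F n k‖ ^ 2 =
      (N : ℝ) * (L : ℝ) ^ d * ∑ n ∈ Icc A (B + P), ∑ k, ‖((fwdDiff (-1 : ℤ))^[P] (fun m => F m k)) n‖ ^ 2 := by
  rw [sum_comm]
  have hcx : ∀ x : TorusSite d L, ∀ n, n ∉ Icc A B → (fun m => ∑ k : TorusSite d L, torusChar k x * F m k) n = 0 := by
    intro x n hn
    simp [hF n hn]
  have hdiff : ∀ (x : TorusSite d L) (n : ℤ),
      ((fwdDiff (-1 : ℤ))^[P] (fun m => ∑ k : TorusSite d L, torusChar k x * F m k)) n =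
      ∑ k : TorusSite d L, torusChar k x * ((fwdDiff (-1 : ℤ))^[P] (fun m => F m k)) n := by
    intro x n
    have h1 : (fun m => ∑ k : TorusSite d L, torusChar k x * F m k) =
        ∑ k : TorusSite d L, (torusChar k x • fun m => F m k) := by
      ext m; simp [Finset.sum_apply, smul_eq_mul]
    rw [h1, fwdDiff_iter_finsetSum, Finset.sum_apply]
    refine sum_congr rfl fun k _ => ?_
    rw [fwdDiff_iter_const_smul, Pi.smul_apply, smul_eq_mul]
  calc ∑ x : TorusSite d L, ∑ j : Fin N, (2 * |Real.sin (π * (j : ℕ) / N)|) ^ (2 * P) *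
          ‖∑ n ∈ Icc A B, cexp (-(I * ((π * (2 * (n : ℝ) + 1) / β * gridTime β N j : ℝ) : ℂ))) *
              ∑ k, torusChar k x * F n k‖ ^ 2
      = ∑ x : TorusSite d L, (N : ℝ) * ∑ n ∈ Icc A (B + P),
          ‖∑ k, torusChar k x * ((fwdDiff (-1 : ℤ))^[P] (fun m => F m k)) n‖ ^ 2 := by
        refine sum_congr rfl fun x _ => ?_
        rw [sum_sin_pow_mul_norm_sq_matsubara_sum_gridTime hβ P hAB _ (hcx x)]
        simp_rw [hdiff]
    _ = (N : ℝ) * (L : ℝ) ^ d * ∑ n ∈ Icc A (B + P), ∑ k, ‖((fwdDiff (-1 : ℤ))^[P] (fun m => F m k)) n‖ ^ 2 := by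
        rw [← mul_sum, sum_comm]
        simp_rw [sum_norm_sq_sum_torusChar_mul]
        rw [← mul_sum]
        ring

/-- **Space-weighted joint Plancherel**: for a direction `v` of the dual torus and `P` differences (window `B - A + 1 ≤ N`),
`Σ_{j<N} Σ_x (4|ã_v(x)|/L)^{2P} ‖K(j,x)‖² ≤ N L^d Σ_{n∈[A,B]} Σ_k ‖(Δ_v^P F(n,·))(k)‖²`.
[cite: BenfattoGiulianiMastropietro2006, Lemma 2.2 and (2.36aa)] -/
theorem sum_sum_spaceWeight_mul_norm_sq_gridKernel_le {β : ℝ} (hβ : β ≠ 0) {N : ℕ} {A B : ℤ} (hAB : B - A + 1 ≤ N)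
    (F : ℤ → TorusSite d L → ℂ) (v : TorusSite d L) (P : ℕ) :
    ∑ j : Fin N, ∑ x : TorusSite d L, (4 * |((∑ i, v i * x i).valMinAbs : ℝ)| / L) ^ (2 * P) *
        ‖∑ n ∈ Icc A B, cexp (-(I * ((π * (2 * (n : ℝ) + 1) / β * gridTime β N j : ℝ) : ℂ))) *
            ∑ k, torusChar k x * F n k‖ ^ 2 ≤
      (N : ℝ) * (L : ℝ) ^ d * ∑ n ∈ Icc A B, ∑ k, ‖((fwdDiff v)^[P] (F n)) k‖ ^ 2 := by
  have hdiff : ∀ (j : Fin N) (k : TorusSite d L),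
      ((fwdDiff v)^[P] (fun k' => ∑ n ∈ Icc A B,
        cexp (-(I * ((π * (2 * (n : ℝ) + 1) / β * gridTime β N j : ℝ) : ℂ))) * F n k')) k =
      ∑ n ∈ Icc A B, cexp (-(I * ((π * (2 * (n : ℝ) + 1) / β * gridTime β N j : ℝ) : ℂ))) *
        ((fwdDiff v)^[P] (F n)) k := by
    intro j k
    have h1 : (fun k' => ∑ n ∈ Icc A B, cexp (-(I * ((π * (2 * (n : ℝ) + 1) / β * gridTime β N j : ℝ) : ℂ))) * F n k') =
        ∑ n ∈ Icc A B, (cexp (-(I * ((π * (2 * (n : ℝ) + 1) / β * gridTime β N j : ℝ) : ℂ))) • F n) := by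
      ext k'; simp [Finset.sum_apply, smul_eq_mul]
    rw [h1, fwdDiff_iter_finsetSum, Finset.sum_apply]
    refine sum_congr rfl fun n _ => ?_
    rw [fwdDiff_iter_const_smul, Pi.smul_apply, smul_eq_mul]
  calc ∑ j : Fin N, ∑ x : TorusSite d L, (4 * |((∑ i, v i * x i).valMinAbs : ℝ)| / L) ^ (2 * P) *
          ‖∑ n ∈ Icc A B, cexp (-(I * ((π * (2 * (n : ℝ) + 1) / β * gridTime β N j : ℝ) : ℂ))) *
              ∑ k, torusChar k x * F n k‖ ^ 2
      ≤ ∑ j : Fin N, (L : ℝ) ^ d * ∑ k, ‖∑ n ∈ Icc A B,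
          cexp (-(I * ((π * (2 * (n : ℝ) + 1) / β * gridTime β N j : ℝ) : ℂ))) * ((fwdDiff v)^[P] (F n)) k‖ ^ 2 := by
        refine sum_le_sum fun j _ => ?_
        simp_rw [gridKernel_eq_sum_torusChar]
        refine (sum_weight_mul_norm_sq_le _ v P).trans (le_of_eq ?_)
        simp_rw [hdiff]
    _ = (N : ℝ) * (L : ℝ) ^ d * ∑ n ∈ Icc A B, ∑ k, ‖((fwdDiff v)^[P] (F n)) k‖ ^ 2 := by
        rw [← mul_sum, sum_comm]
        simp_rw [sum_norm_sq_matsubara_sum_gridTime hβ hAB]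
        rw [← mul_sum, sum_comm]
        ring

/-- **Time-weighted joint Plancherel, chord form**: `Σ_{j<N} Σ_x (4|j̃|/N)^{2P} ‖K(j,x)‖² ≤ N L^d Σ_{n∈[A,B+P]} Σ_k ‖(∇_n^P F)(n,k)‖²`.
[cite: BenfattoGiulianiMastropietro2006, §2.5 Lemma 2.2 (2.56)] -/
theorem sum_sum_timeWeight_mul_norm_sq_gridKernel_le {β : ℝ} (hβ : β ≠ 0) {N : ℕ} [NeZero N] {A B : ℤ} (P : ℕ)
    (hAB : B + P - A + 1 ≤ N) (F : ℤ → TorusSite d L → ℂ) (hF : ∀ n, n ∉ Icc A B → F n = 0) :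
    ∑ j : Fin N, ∑ x : TorusSite d L, (4 * |(((j : ℕ) : ZMod N).valMinAbs : ℝ)| / N) ^ (2 * P) *
        ‖∑ n ∈ Icc A B, cexp (-(I * ((π * (2 * (n : ℝ) + 1) / β * gridTime β N j : ℝ) : ℂ))) *
            ∑ k, torusChar k x * F n k‖ ^ 2 ≤
      (N : ℝ) * (L : ℝ) ^ d * ∑ n ∈ Icc A (B + P), ∑ k, ‖((fwdDiff (-1 : ℤ))^[P] (fun m => F m k)) n‖ ^ 2 := by
  rw [← sum_sum_sin_pow_mul_norm_sq_gridKernel hβ P hAB F hF]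
  refine sum_le_sum fun j _ => sum_le_sum fun x _ => mul_le_mul_of_nonneg_right ?_ (sq_nonneg _)
  exact pow_le_pow_left₀ (by positivity) (four_mul_abs_valMinAbs_div_le N j) _

omit [NeZero L] in
/-- **Cauchy–Schwarz with a positive weight**: `Σ_x ‖g(x)‖ ≤ (Σ_x W(x)⁻¹)^{1/2} (Σ_x W(x) ‖g(x)‖²)^{1/2}`. [folklore] -/
private theorem sum_norm_le_sqrt_mul_sqrt_of_weight {ι : Type*} (s : Finset ι) (g : ι → ℂ) (W : ι → ℝ)
    (hW : ∀ x ∈ s, 0 < W x) :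
    ∑ x ∈ s, ‖g x‖ ≤ Real.sqrt (∑ x ∈ s, (W x)⁻¹) * Real.sqrt (∑ x ∈ s, W x * ‖g x‖ ^ 2) := by
  have hcs := sum_mul_sq_le_sq_mul_sq s (fun x => Real.sqrt ((W x)⁻¹)) (fun x => Real.sqrt (W x) * ‖g x‖)
  have hprod : ∀ x ∈ s, Real.sqrt ((W x)⁻¹) * (Real.sqrt (W x) * ‖g x‖) = ‖g x‖ := by
    intro x hx
    have hWx := hW x hx
    rw [← mul_assoc, Real.sqrt_inv, inv_mul_cancel₀ (Real.sqrt_ne_zero'.2 hWx), one_mul]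
  have h1 : ∀ x ∈ s, Real.sqrt ((W x)⁻¹) ^ 2 = (W x)⁻¹ := fun x hx =>
    Real.sq_sqrt (inv_nonneg.2 (hW x hx).le)
  have h2 : ∀ x ∈ s, (Real.sqrt (W x) * ‖g x‖) ^ 2 = W x * ‖g x‖ ^ 2 := fun x hx => by
    rw [mul_pow, Real.sq_sqrt (hW x hx).le]
  rw [sum_congr rfl hprod, sum_congr rfl h1, sum_congr rfl h2] at hcs
  have hA : 0 ≤ ∑ x ∈ s, (W x)⁻¹ := sum_nonneg fun x hx => inv_nonneg.2 (hW x hx).le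
  have hS : 0 ≤ ∑ x ∈ s, ‖g x‖ := sum_nonneg fun x _ => norm_nonneg _
  rw [← Real.sqrt_mul hA, ← Real.sqrt_sq hS]
  exact Real.sqrt_le_sqrt hcs

/-- **The `ℓ¹` norm of a space–time kernel from `ℓ²` norms of symbol differences** (weighted Plancherel on the time
grid × the torus, then Cauchy–Schwarz with the ADDITIVE weight
`W(j,x) = 1 + c_τ (4|j̃|/N)^{2P_τ} + Σ_i c_i (4|ã_{v_i}(x)|/L)^{2P}`): for `F` vanishing off the frequency window `[A, B]`
with `B + P_τ - A + 1 ≤ N`, nonnegative `c_τ`, `c_i`,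
`Σ_{j<N} Σ_x ‖K(j,x)‖ ≤ (Σ_{j,x} W⁻¹)^{1/2} · (N L^d [Σ‖F‖² + c_τ Σ‖∇_n^{P_τ}F‖² + Σ_i c_i Σ‖Δ_{v_i}^P F‖²])^{1/2}`,
`K(j,x) = Σ_{n∈[A,B]} e^{-iω_nτ_j} Σ_k χ_k(x) F(n,k)`.  The geometry of the weight (`Σ W⁻¹`) and the mean-value bounds on
the differences of a concrete symbol are left to the user. [cite: BenfattoGiulianiMastropietro2006, Lemma 2.2 and footnote 1] -/
theorem sum_norm_gridKernel_le {β : ℝ} (hβ : β ≠ 0) {N : ℕ} [NeZero N] {A B : ℤ} (Pτ : ℕ)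
    (hAB : B + Pτ - A + 1 ≤ N) (F : ℤ → TorusSite d L → ℂ) (hF : ∀ n, n ∉ Icc A B → F n = 0)
    {cτ : ℝ} (hcτ : 0 ≤ cτ) {ι : Type*} (T : Finset ι) (v : ι → TorusSite d L) (c : ι → ℝ)
    (hc : ∀ i ∈ T, 0 ≤ c i) (P : ℕ) :
    ∑ j : Fin N, ∑ x : TorusSite d L,
        ‖∑ n ∈ Icc A B, cexp (-(I * ((π * (2 * (n : ℝ) + 1) / β * gridTime β N j : ℝ) : ℂ))) *
            ∑ k, torusChar k x * F n k‖ ≤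
      Real.sqrt (∑ j : Fin N, ∑ x : TorusSite d L,
          (1 + cτ * (4 * |(((j : ℕ) : ZMod N).valMinAbs : ℝ)| / N) ^ (2 * Pτ) +
              ∑ i ∈ T, c i * (4 * |((∑ l, v i l * x l).valMinAbs : ℝ)| / L) ^ (2 * P))⁻¹) *
        Real.sqrt ((N : ℝ) * (L : ℝ) ^ d *
          (∑ n ∈ Icc A B, ∑ k, ‖F n k‖ ^ 2 +
            cτ * ∑ n ∈ Icc A (B + Pτ), ∑ k, ‖((fwdDiff (-1 : ℤ))^[Pτ] (fun m => F m k)) n‖ ^ 2 +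
            ∑ i ∈ T, c i * ∑ n ∈ Icc A B, ∑ k, ‖((fwdDiff (v i))^[P] (F n)) k‖ ^ 2)) := by
  have hAB' : B - A + 1 ≤ N := by omega
  -- notation
  set K : Fin N → TorusSite d L → ℂ := fun j x =>
    ∑ n ∈ Icc A B, cexp (-(I * ((π * (2 * (n : ℝ) + 1) / β * gridTime β N j : ℝ) : ℂ))) *
      ∑ k, torusChar k x * F n k with hK
  set wτ : Fin N → ℝ := fun j => (4 * |(((j : ℕ) : ZMod N).valMinAbs : ℝ)| / N) ^ (2 * Pτ) with hwτ
  set wx : ι → TorusSite d L → ℝ := fun i x => (4 * |((∑ l, v i l * x l).valMinAbs : ℝ)| / L) ^ (2 * P) with hwx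
  set W : Fin N × TorusSite d L → ℝ := fun p => 1 + cτ * wτ p.1 + ∑ i ∈ T, c i * wx i p.2 with hW
  have hWpos : ∀ p ∈ (univ : Finset (Fin N × TorusSite d L)), 0 < W p := fun p _ => by
    rw [hW]
    refine add_pos_of_pos_of_nonneg (add_pos_of_pos_of_nonneg one_pos (mul_nonneg hcτ (by positivity))) ?_
    exact sum_nonneg fun i hi => mul_nonneg (hc i hi) (by positivity)
  -- Cauchy–Schwarz over the product index
  have hCS := sum_norm_le_sqrt_mul_sqrt_of_weight univ (fun p : Fin N × TorusSite d L => K p.1 p.2) W hWpos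
  rw [Fintype.sum_prod_type, Fintype.sum_prod_type, Fintype.sum_prod_type] at hCS
  refine hCS.trans (mul_le_mul_of_nonneg_left (Real.sqrt_le_sqrt ?_) (Real.sqrt_nonneg _))
  -- split the weighted sum
  have hsplit : ∑ j : Fin N, ∑ x : TorusSite d L, W (j, x) * ‖K j x‖ ^ 2 =
      ∑ j : Fin N, ∑ x : TorusSite d L, ‖K j x‖ ^ 2 +
        cτ * ∑ j : Fin N, ∑ x : TorusSite d L, wτ j * ‖K j x‖ ^ 2 +
        ∑ i ∈ T, c i * ∑ j : Fin N, ∑ x : TorusSite d L, wx i x * ‖K j x‖ ^ 2 := by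
    have hpt : ∀ (j : Fin N) (x : TorusSite d L), W (j, x) * ‖K j x‖ ^ 2 =
        ‖K j x‖ ^ 2 + cτ * (wτ j * ‖K j x‖ ^ 2) + ∑ i ∈ T, c i * (wx i x * ‖K j x‖ ^ 2) := by
      intro j x
      rw [hW]
      have h3 : ∑ i ∈ T, c i * (wx i x * ‖K j x‖ ^ 2) = (∑ i ∈ T, c i * wx i x) * ‖K j x‖ ^ 2 := by
        rw [sum_mul]
        exact sum_congr rfl fun i _ => by ring
      rw [h3]
      ring
    have h3 : ∑ j : Fin N, ∑ x : TorusSite d L, ∑ i ∈ T, c i * (wx i x * ‖K j x‖ ^ 2) =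
        ∑ i ∈ T, c i * ∑ j : Fin N, ∑ x : TorusSite d L, wx i x * ‖K j x‖ ^ 2 := by
      calc ∑ j : Fin N, ∑ x : TorusSite d L, ∑ i ∈ T, c i * (wx i x * ‖K j x‖ ^ 2)
          = ∑ j : Fin N, ∑ i ∈ T, ∑ x : TorusSite d L, c i * (wx i x * ‖K j x‖ ^ 2) :=
            sum_congr rfl fun j _ => sum_comm
        _ = ∑ i ∈ T, ∑ j : Fin N, ∑ x : TorusSite d L, c i * (wx i x * ‖K j x‖ ^ 2) := sum_comm
        _ = ∑ i ∈ T, c i * ∑ j : Fin N, ∑ x : TorusSite d L, wx i x * ‖K j x‖ ^ 2 := by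
            simp_rw [mul_sum]
    simp_rw [hpt, sum_add_distrib]
    rw [h3]
    simp_rw [← mul_sum]
  rw [hsplit, mul_add, mul_add]
  refine add_le_add (add_le_add (le_of_eq ?_) ?_) ?_
  · exact sum_sum_norm_sq_gridKernel hβ hAB' F
  · rw [mul_left_comm]
    exact mul_le_mul_of_nonneg_left (sum_sum_timeWeight_mul_norm_sq_gridKernel_le hβ Pτ hAB F hF) hcτ
  · rw [mul_sum]
    refine sum_le_sum fun i hi => ?_
    rw [mul_left_comm]
    exact mul_le_mul_of_nonneg_left (sum_sum_spaceWeight_mul_norm_sq_gridKernel_le hβ hAB' F (v i) P) (hc i hi)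

end SpaceTime

end Literature.MathematicalPhysics.QuantumLattice

end
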